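import Summits.CriticalPhenomena.PercolationContinuityZ3.Theorems.PercNearOneGluingNoHeavyLowerTailJBernSunflowerKleitmanGram
import HarnessLib

/-!
# `NoHeavyLowerTail` (crux stmt-CriticalPhenomena-4575), hull-port line hp-7: SUNFLOWER–KLEITMAN (W-Λ) for acyclic orientations, II —
# the cross-head Gram entries vanish unless `ρ s₀ = ρ(univ∖s)` (F2)

Support file (prover `prim-hp-7`, generation 49; `--supports stmt-CriticalPhenomena-4575`).  No definitions, no `sorry`, standard axioms.
Memo: `prim-hp-7/FROM-prim-hp-7-g49-WLAMBDA-ACYCLIC.md`.  Part 2 of 3 (after `…JBernSunflowerKleitmanGram`).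

SETTING (all three files).  A monotone labelling of the cube `2^α` by `⊤` (the up-set `K`), `⊥` (the down-set `D`, disjoint from `K`) and
finitely many middle labels, encoded by a rank function `ρ` that is constant along inclusions inside the middle zone (`hρ`): the classes
`{x ∉ K ∪ D : ρ x = c}` are the PETALS of a sunflower of up-sets `G_c = K ∪ petal_c` with kernel `K` (memo g48 §2: "sunflower–Kleitman" = hp-7's
W-Λ rows = an increasing-injection form of Gladkov's strong Harris–Kleitman inequality).  SOURCES: `ζ` with `ζ, univ∖ζ` both middle and
`ρ ζ < ρ (univ∖ζ)` (an oriented pair of distinct petals, the orientation being ACYCLIC = along `ρ`); TARGETS: `ζ ∈ K` with `univ∖ζ ∈ D`.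
THE THEOREM (file `…Acyclic`, `JBern.card_filter_source_le_card_filter_target`): for every up-set `𝒰`, `#(sources ∩ 𝒰) ≤ #(targets ∩ 𝒰)`.
METHOD: the `sources × targets` matrix `A[s,t] = #{C ∈ G_{ρ(univ∖s)} : univ∖t ⊆ C ⊆ univ∖s} (mod 2)` is supported on `s ⊆ t` and has FULL ROW
RANK over `GF(2)`; pairing its rows with the test vectors `y_{s₀}[t] = #{R : univ∖t ⊆ R ⊆ univ∖s₀, univ∖R ∈ G_{ρ(univ∖s₀)}}` gives the Gram
entries `[s = s₀]` for sources with the same head (F1, this file: prim-l12-p2's parity lemma `Ξ² = I`, `HallGladkov.gam_del_sum`, transposed through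
`mul_eq_one_comm`, plus the vanishing of the rows off the target columns) and `0` for different heads unless `ρ s₀ = ρ(univ∖s)` (F2, file `…Cross`);
so a vanishing combination of rows dies along `ρ` (file `…Acyclic`), and rows inside an up-set being supported on columns inside it, the counting
inequality is a `finrank` comparison.
THIS FILE: (F2) `gram_cross_eq_zero` — a direct parity computation: after summing over the targets the triple count splits into the pairs
`(C,R)` with `C ∩ R = ∅`, which count the supersets of the KERNEL set `s₀ ∪ C` (an even number unless `s₀ ∪ C = univ`, which is excluded), and a part
supported on `C = univ∖s ⊆ univ∖s₀`, which is empty for different heads. [this work]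
-/

namespace Summit.CriticalPhenomena.PercolationContinuityZ3.Theorems.JBern

open Finset
open Summit.CriticalPhenomena.PercolationContinuityZ3.Theorems.SunflowerPartition.HallGladkov

variable {α : Type*} [Fintype α] [DecidableEq α]

section Cross

variable (K D : Finset (Finset α)) (ρ : Finset α → ℕ)

/-- For a source `s₀` the test vector only sees the kernel: for `R ⊆ univ∖s₀`, `univ∖R ∈ G_{ρ(univ∖s₀)} ↔ univ∖R ∈ K`. [this work] -/
theorem testvec_eq_kernel_form
    (hρ : ∀ s t : Finset α, s ⊆ t → s ∉ D → t ∉ K → ρ s = ρ t)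
    {s₀ : Finset α} (hs₀D : s₀ ∉ D) (hlt₀ : ρ s₀ < ρ (univ \ s₀)) (T : Finset α) :
    (∑ R ∈ (univ : Finset α).powerset,
        (if T ⊆ R ∧ R ⊆ univ \ s₀ ∧ univ \ R ∈ ((univ : Finset (Finset α)).filter fun x => x ∈ K ∨ (x ∉ D ∧ ρ x = ρ (univ \ s₀)))
          then (1 : ZMod 2) else 0))
      = ∑ R ∈ (univ : Finset α).powerset, (if T ⊆ R ∧ R ⊆ univ \ s₀ ∧ univ \ R ∈ K then (1 : ZMod 2) else 0) := by
  refine sum_congr rfl fun R _ => ?_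
  by_cases h : T ⊆ R ∧ R ⊆ univ \ s₀
  · have hsub : s₀ ⊆ univ \ R := by
      intro x hx
      rw [mem_sdiff]
      exact ⟨mem_univ x, fun hxR => (mem_sdiff.1 (h.2 hxR)).2 hx⟩
    have hiff : univ \ R ∈ ((univ : Finset (Finset α)).filter fun x => x ∈ K ∨ (x ∉ D ∧ ρ x = ρ (univ \ s₀))) ↔ univ \ R ∈ K := by
      rw [mem_G_iff]
      constructor
      · rintro (hK' | ⟨-, hRc⟩)
        · exact hK'
        · by_contra hRK
          exact (ne_of_lt hlt₀) ((hρ s₀ (univ \ R) hsub hs₀D hRK).trans hRc)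
      · exact fun hK' => Or.inl hK'
    by_cases hG : univ \ R ∈ ((univ : Finset (Finset α)).filter fun x => x ∈ K ∨ (x ∉ D ∧ ρ x = ρ (univ \ s₀)))
    · rw [if_pos ⟨h.1, h.2, hG⟩, if_pos ⟨h.1, h.2, hiff.1 hG⟩]
    · rw [if_neg (fun h' => hG h'.2.2), if_neg (fun h' => hG (hiff.2 h'.2.2))]
  · rw [if_neg (fun h' => h ⟨h'.1, h'.2.1⟩), if_neg (fun h' => h ⟨h'.1, h'.2.1⟩)]

/-- Parity of the subsets of `B` inside the full cube: `#{O : O ⊆ B} ≡ [B = ∅]`. [folklore] -/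
theorem sum_univ_powerset_ite_subset (B : Finset α) :
    (∑ O ∈ (univ : Finset α).powerset, (if O ⊆ B then (1 : ZMod 2) else 0)) = if B = ∅ then 1 else 0 := by
  have h := sum_powerset_ite_Icc (A := (∅ : Finset α)) (B := B) (W := univ) (subset_univ B)
  rw [show (∑ R ∈ (univ : Finset α).powerset, (if ∅ ⊆ R ∧ R ⊆ B then (1 : ZMod 2) else 0))
      = ∑ O ∈ (univ : Finset α).powerset, (if O ⊆ B then (1 : ZMod 2) else 0) from
    sum_congr rfl fun R _ => by simp only [empty_subset, true_and]] at h
  rw [h]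
  by_cases hB : B = ∅
  · rw [if_pos hB.symm, if_pos hB]
  · rw [if_neg (Ne.symm hB), if_neg hB]

/-- **(F2) Different heads: the Gram entry vanishes unless `ρ s₀ = ρ(univ∖s)`.**  For sources `s, s₀` with `ρ(univ∖s) ≠ ρ(univ∖s₀)` and
`ρ s₀ ≠ ρ(univ∖s)`:  `Σ_{t target} δ_{G_{ρ(univ∖s)}}(univ∖s, univ∖t) · γ_{G_{ρ(univ∖s₀)}}(univ∖t, univ∖s₀) = 0` over `GF(2)`.
Direct parity computation: after summing over `t` the triple count splits into `#{(C,R) : C ∩ R = ∅}` — which counts supersets of the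
kernel set `s₀ ∪ C`, an even number — and a part supported on `C = univ∖s ⊆ univ∖s₀`, which is empty. [this work] -/
theorem gram_cross_eq_zero (hK : IsUpperSet (K : Set (Finset α))) (hD : IsLowerSet (D : Set (Finset α)))
    (hρ : ∀ s t : Finset α, s ⊆ t → s ∉ D → t ∉ K → ρ s = ρ t)
    {s : Finset α} (hscK : univ \ s ∉ K) (hscD : univ \ s ∉ D)
    {s₀ : Finset α} (hs₀D : s₀ ∉ D) (hs₀cK : univ \ s₀ ∉ K) (hs₀cD : univ \ s₀ ∉ D) (hlt₀ : ρ s₀ < ρ (univ \ s₀))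
    (hne : ρ (univ \ s) ≠ ρ (univ \ s₀)) (htail : ρ s₀ ≠ ρ (univ \ s)) :
    (∑ t ∈ (univ : Finset α).powerset.filter (fun t => t ∈ K ∧ univ \ t ∈ D),
        (∑ C ∈ (univ : Finset α).powerset,
            (if C ∈ ((univ : Finset (Finset α)).filter fun x => x ∈ K ∨ (x ∉ D ∧ ρ x = ρ (univ \ s))) ∧ univ \ t ⊆ C ∧ C ⊆ univ \ s
              then (1 : ZMod 2) else 0)) *
        (∑ R ∈ (univ : Finset α).powerset,
            (if univ \ t ⊆ R ∧ R ⊆ univ \ s₀ ∧ univ \ R ∈ ((univ : Finset (Finset α)).filter fun x => x ∈ K ∨ (x ∉ D ∧ ρ x = ρ (univ \ s₀)))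
              then (1 : ZMod 2) else 0)))
      = 0 := by
  set G := ((univ : Finset (Finset α)).filter fun x => x ∈ K ∨ (x ∉ D ∧ ρ x = ρ (univ \ s))) with hGdef
  set Tg := (univ : Finset α).powerset.filter (fun t => t ∈ K ∧ univ \ t ∈ D) with hTg
  have hG : IsUpperSet (G : Set (Finset α)) := isUpperSet_G K D ρ hK hD hρ _
  -- bookkeeping facts about `C ∈ G` below `univ \ s`
  have hCfacts : ∀ C : Finset α, C ∈ G → C ⊆ univ \ s → (C ∉ K ∧ C ∉ D ∧ ρ C = ρ (univ \ s)) := by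
    intro C hCG hCs
    have hCK : C ∉ K := fun h => hscK (hK hCs h)
    rw [mem_G_iff] at hCG
    rcases hCG with h | ⟨hCD, hCc⟩
    · exact absurd h hCK
    · exact ⟨hCK, hCD, hCc⟩
  -- Step A: rewrite the test vector in kernel form
  rw [show (∑ t ∈ Tg,
        (∑ C ∈ (univ : Finset α).powerset, (if C ∈ G ∧ univ \ t ⊆ C ∧ C ⊆ univ \ s then (1 : ZMod 2) else 0)) *
        (∑ R ∈ (univ : Finset α).powerset,
            (if univ \ t ⊆ R ∧ R ⊆ univ \ s₀ ∧ univ \ R ∈ ((univ : Finset (Finset α)).filter fun x => x ∈ K ∨ (x ∉ D ∧ ρ x = ρ (univ \ s₀)))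
              then (1 : ZMod 2) else 0)))
      = ∑ t ∈ Tg,
        (∑ C ∈ (univ : Finset α).powerset, (if C ∈ G ∧ univ \ t ⊆ C ∧ C ⊆ univ \ s then (1 : ZMod 2) else 0)) *
        (∑ R ∈ (univ : Finset α).powerset, (if univ \ t ⊆ R ∧ R ⊆ univ \ s₀ ∧ univ \ R ∈ K then (1 : ZMod 2) else 0)) from
    sum_congr rfl fun t _ => by rw [testvec_eq_kernel_form K D ρ hρ hs₀D hlt₀]]
  -- Step B: expand the product and bring the `t`-sum inside
  have hB : ∀ t ∈ Tg,
      (∑ C ∈ (univ : Finset α).powerset, (if C ∈ G ∧ univ \ t ⊆ C ∧ C ⊆ univ \ s then (1 : ZMod 2) else 0)) *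
        (∑ R ∈ (univ : Finset α).powerset, (if univ \ t ⊆ R ∧ R ⊆ univ \ s₀ ∧ univ \ R ∈ K then (1 : ZMod 2) else 0))
      = ∑ C ∈ (univ : Finset α).powerset, ∑ R ∈ (univ : Finset α).powerset,
          (if (C ∈ G ∧ C ⊆ univ \ s ∧ R ⊆ univ \ s₀ ∧ univ \ R ∈ K) then
            (if univ \ t ⊆ C ∧ univ \ t ⊆ R then (1 : ZMod 2) else 0) else 0) := by
    intro t _
    rw [Finset.sum_mul_sum]
    refine sum_congr rfl fun C _ => sum_congr rfl fun R _ => ?_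
    rw [ite_zero_mul_ite_zero, one_mul]
    by_cases h1 : C ∈ G ∧ C ⊆ univ \ s ∧ R ⊆ univ \ s₀ ∧ univ \ R ∈ K
    · rw [if_pos h1]
      by_cases h2 : univ \ t ⊆ C ∧ univ \ t ⊆ R
      · rw [if_pos ⟨⟨h1.1, h2.1, h1.2.1⟩, h2.2, h1.2.2.1, h1.2.2.2⟩, if_pos h2]
      · rw [if_neg (fun h => h2 ⟨h.1.2.1, h.2.1⟩), if_neg h2]
    · rw [if_neg h1, if_neg]
      rintro ⟨⟨hCG, -, hCs⟩, -, hRs, hRK⟩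
      exact h1 ⟨hCG, hCs, hRs, hRK⟩
  rw [sum_congr rfl hB, Finset.sum_comm]
  rw [show (∑ C ∈ (univ : Finset α).powerset, ∑ t ∈ Tg, ∑ R ∈ (univ : Finset α).powerset,
          (if (C ∈ G ∧ C ⊆ univ \ s ∧ R ⊆ univ \ s₀ ∧ univ \ R ∈ K) then
            (if univ \ t ⊆ C ∧ univ \ t ⊆ R then (1 : ZMod 2) else 0) else 0))
      = ∑ C ∈ (univ : Finset α).powerset, ∑ R ∈ (univ : Finset α).powerset,
          (if (C ∈ G ∧ C ⊆ univ \ s ∧ R ⊆ univ \ s₀ ∧ univ \ R ∈ K) then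
            (∑ t ∈ Tg, (if univ \ t ⊆ C ∧ univ \ t ⊆ R then (1 : ZMod 2) else 0)) else 0) from
    sum_congr rfl fun C _ => by
      rw [Finset.sum_comm]
      exact sum_congr rfl fun R _ => by rw [Finset.sum_ite_irrel, Finset.sum_const_zero]]
  -- Step C: the inner `t`-sum, for admissible `(C, R)`
  have hC : ∀ C R : Finset α, C ∈ G → C ⊆ univ \ s → univ \ R ∈ K →
      (∑ t ∈ Tg, (if univ \ t ⊆ C ∧ univ \ t ⊆ R then (1 : ZMod 2) else 0))
        = (if C ∩ R = ∅ then (1 : ZMod 2) else 0)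
          - ∑ O ∈ (univ : Finset α).powerset, (if O ∈ G ∧ O ⊆ C ∧ O ⊆ R then (1 : ZMod 2) else 0) := by
    intro C R hCG hCs hRK
    obtain ⟨hCK, hCD, hCc⟩ := hCfacts C hCG hCs
    -- (i) rewrite the sum over targets as a sum over `O = univ \ t`
    have h1 : (∑ t ∈ Tg, (if univ \ t ⊆ C ∧ univ \ t ⊆ R then (1 : ZMod 2) else 0))
        = ∑ O ∈ (univ : Finset α).powerset, (if O ∈ D ∧ O ⊆ C ∧ O ⊆ R then (1 : ZMod 2) else 0) := by
      rw [hTg, Finset.sum_filter]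
      rw [← sum_powerset_compl (univ : Finset α)
        (fun O => if O ∈ D ∧ O ⊆ C ∧ O ⊆ R then (1 : ZMod 2) else 0)]
      refine sum_congr rfl fun t ht => ?_
      by_cases hT : t ∈ K ∧ univ \ t ∈ D
      · rw [if_pos hT]
        by_cases h2 : univ \ t ⊆ C ∧ univ \ t ⊆ R
        · rw [if_pos h2, if_pos ⟨hT.2, h2.1, h2.2⟩]
        · rw [if_neg h2, if_neg (fun h => h2 ⟨h.2.1, h.2.2⟩)]
      · rw [if_neg hT, if_neg]
        rintro ⟨hOD, hOC, hOR⟩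
        apply hT
        refine ⟨?_, hOD⟩
        -- `t ⊇ univ \ R`... : `t = univ \ (univ \ t)` contains `univ \ R ∈ K`
        have : univ \ R ⊆ t := by
          intro x hx
          by_contra hxt
          have hx' : x ∈ univ \ t := mem_sdiff.2 ⟨mem_univ x, hxt⟩
          exact (mem_sdiff.1 hx).2 (hOR hx')
        exact hK this hRK
    -- (ii) `[O ∈ D ∧ O ⊆ C ∧ O ⊆ R] = [O ⊆ C ∩ R] - [O ∈ G ∧ O ⊆ C ∧ O ⊆ R]`
    have h2 : ∀ O ∈ (univ : Finset α).powerset,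
        (if O ∈ D ∧ O ⊆ C ∧ O ⊆ R then (1 : ZMod 2) else 0)
          = (if O ⊆ C ∩ R then (1 : ZMod 2) else 0) - (if O ∈ G ∧ O ⊆ C ∧ O ⊆ R then (1 : ZMod 2) else 0) := by
      intro O _
      by_cases hOCR : O ⊆ C ∧ O ⊆ R
      · rw [if_pos (subset_inter hOCR.1 hOCR.2)]
        have hOK : O ∉ K := fun h => hCK (hK hOCR.1 h)
        by_cases hOD : O ∈ D
        · rw [if_pos ⟨hOD, hOCR⟩, if_neg, sub_zero]
          rintro ⟨hOG, -⟩
          rw [mem_G_iff] at hOG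
          rcases hOG with h | ⟨h, -⟩
          · exact hOK h
          · exact h hOD
        · have hOG : O ∈ G := by
            rw [mem_G_iff]
            exact Or.inr ⟨hOD, (hρ O C hOCR.1 hOD hCK).trans hCc⟩
          rw [if_neg (fun h => hOD h.1), if_pos ⟨hOG, hOCR⟩, sub_self]
      · rw [if_neg (fun h => hOCR h.2), if_neg (fun h => hOCR (subset_inter_iff.1 h)), if_neg (fun h => hOCR h.2), sub_zero]
    rw [h1, sum_congr rfl h2, Finset.sum_sub_distrib, sum_univ_powerset_ite_subset]
  rw [show (∑ C ∈ (univ : Finset α).powerset, ∑ R ∈ (univ : Finset α).powerset,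
          (if (C ∈ G ∧ C ⊆ univ \ s ∧ R ⊆ univ \ s₀ ∧ univ \ R ∈ K) then
            (∑ t ∈ Tg, (if univ \ t ⊆ C ∧ univ \ t ⊆ R then (1 : ZMod 2) else 0)) else 0))
      = ∑ C ∈ (univ : Finset α).powerset, ∑ R ∈ (univ : Finset α).powerset,
          ((if (C ∈ G ∧ C ⊆ univ \ s ∧ R ⊆ univ \ s₀ ∧ univ \ R ∈ K ∧ C ∩ R = ∅) then (1 : ZMod 2) else 0)
           - (if (C ∈ G ∧ C ⊆ univ \ s ∧ R ⊆ univ \ s₀ ∧ univ \ R ∈ K) then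
               (∑ O ∈ (univ : Finset α).powerset, (if O ∈ G ∧ O ⊆ C ∧ O ⊆ R then (1 : ZMod 2) else 0)) else 0)) from
    sum_congr rfl fun C _ => sum_congr rfl fun R _ => by
      by_cases h : C ∈ G ∧ C ⊆ univ \ s ∧ R ⊆ univ \ s₀ ∧ univ \ R ∈ K
      · rw [if_pos h, if_pos h, hC C R h.1 h.2.1 h.2.2.2]
        by_cases he : C ∩ R = ∅
        · rw [if_pos he, if_pos ⟨h.1, h.2.1, h.2.2.1, h.2.2.2, he⟩]
        · rw [if_neg he, if_neg (fun h' => he h'.2.2.2.2)]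
      · rw [if_neg h, if_neg h, if_neg (fun h' => h ⟨h'.1, h'.2.1, h'.2.2.1, h'.2.2.2.1⟩), sub_zero]]
  simp only [Finset.sum_sub_distrib]
  -- Step F: the disjoint part `X1` vanishes
  have hX1 : (∑ C ∈ (univ : Finset α).powerset, ∑ R ∈ (univ : Finset α).powerset,
      (if (C ∈ G ∧ C ⊆ univ \ s ∧ R ⊆ univ \ s₀ ∧ univ \ R ∈ K ∧ C ∩ R = ∅) then (1 : ZMod 2) else 0)) = 0 := by
    refine sum_eq_zero fun C _ => ?_
    by_cases hCG : C ∈ G ∧ C ⊆ univ \ s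
    · obtain ⟨hCK, hCD, hCc⟩ := hCfacts C hCG.1 hCG.2
      -- the kernel set `Y = s₀ ∪ C`
      have hY : s₀ ∪ C ∈ K := by
        by_contra hYK
        have hYD : s₀ ∪ C ∉ D := fun h => hs₀D (hD (subset_union_left (s₂ := C)) h)
        have h1 := hρ s₀ (s₀ ∪ C) subset_union_left hs₀D hYK
        have h2 := hρ C (s₀ ∪ C) subset_union_right hCD hYK
        exact htail (h1.trans (h2.symm.trans hCc))
      -- substitute `R = univ \ V`
      rw [← sum_powerset_compl (univ : Finset α)
        (fun R => if (C ∈ G ∧ C ⊆ univ \ s ∧ R ⊆ univ \ s₀ ∧ univ \ R ∈ K ∧ C ∩ R = ∅) then (1 : ZMod 2) else 0)]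
      rw [show (∑ V ∈ (univ : Finset α).powerset,
            (fun R => if (C ∈ G ∧ C ⊆ univ \ s ∧ R ⊆ univ \ s₀ ∧ univ \ R ∈ K ∧ C ∩ R = ∅) then (1 : ZMod 2) else 0) (univ \ V))
          = ∑ V ∈ (univ : Finset α).powerset, (if s₀ ∪ C ⊆ V then (1 : ZMod 2) else 0) from ?_]
      · rw [sum_powerset_ite_superset, if_neg]
        intro hYu
        -- `s₀ ∪ C = univ` forces `univ \ s₀ ⊆ C ⊆ univ \ s`, contradicting `hne`
        have hsub : univ \ s₀ ⊆ univ \ s := by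
          intro x hx
          have hxu : x ∈ s₀ ∪ C := by rw [hYu]; exact mem_univ x
          rcases mem_union.1 hxu with h | h
          · exact absurd h (mem_sdiff.1 hx).2
          · exact hCG.2 h
        exact hne (hρ (univ \ s₀) (univ \ s) hsub hs₀cD hscK).symm
      · refine sum_congr rfl fun V hV => ?_
        have hVu : V ⊆ univ := subset_univ V
        simp only [Finset.sdiff_sdiff_eq_self hVu]
        by_cases hYV : s₀ ∪ C ⊆ V
        · rw [if_pos hYV, if_pos]
          refine ⟨hCG.1, hCG.2, ?_, hK hYV hY, ?_⟩
          · intro x hx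
            rw [mem_sdiff]
            exact ⟨mem_univ x, fun hx0 => (mem_sdiff.1 hx).2 (hYV (mem_union_left C hx0))⟩
          · rw [← disjoint_iff_inter_eq_empty, Finset.disjoint_left]
            intro x hxC hxV
            exact (mem_sdiff.1 hxV).2 (hYV (mem_union_right s₀ hxC))
        · rw [if_neg hYV, if_neg]
          rintro ⟨-, -, hRs, -, hCR⟩
          apply hYV
          intro x hx
          rcases mem_union.1 hx with h0 | hC'
          · by_contra hxV
            exact (mem_sdiff.1 (hRs (mem_sdiff.2 ⟨mem_univ x, hxV⟩))).2 h0
          · by_contra hxV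
            have : x ∈ C ∩ (univ \ V) := mem_inter.2 ⟨hC', mem_sdiff.2 ⟨mem_univ x, hxV⟩⟩
            rw [hCR] at this
            exact absurd this (by simp)
    · refine sum_eq_zero fun R _ => ?_
      rw [if_neg]
      rintro ⟨h1, h2, -⟩
      exact hCG ⟨h1, h2⟩
  -- Step E: the non-disjoint part `X2` vanishes
  have hX2 : (∑ C ∈ (univ : Finset α).powerset, ∑ R ∈ (univ : Finset α).powerset,
      (if (C ∈ G ∧ C ⊆ univ \ s ∧ R ⊆ univ \ s₀ ∧ univ \ R ∈ K) then
        (∑ O ∈ (univ : Finset α).powerset, (if O ∈ G ∧ O ⊆ C ∧ O ⊆ R then (1 : ZMod 2) else 0)) else 0)) = 0 := by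
    -- rewrite as a triple sum and put the `O`-sum outside
    rw [show (∑ C ∈ (univ : Finset α).powerset, ∑ R ∈ (univ : Finset α).powerset,
        (if (C ∈ G ∧ C ⊆ univ \ s ∧ R ⊆ univ \ s₀ ∧ univ \ R ∈ K) then
          (∑ O ∈ (univ : Finset α).powerset, (if O ∈ G ∧ O ⊆ C ∧ O ⊆ R then (1 : ZMod 2) else 0)) else 0))
        = ∑ O ∈ (univ : Finset α).powerset, ∑ C ∈ (univ : Finset α).powerset, ∑ R ∈ (univ : Finset α).powerset,
            ((if O ∈ G ∧ O ⊆ C ∧ C ⊆ univ \ s then (1 : ZMod 2) else 0) *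
             (if O ⊆ R ∧ R ⊆ univ \ s₀ ∧ univ \ R ∈ K then (1 : ZMod 2) else 0)) from ?_]
    · refine sum_eq_zero fun O _ => ?_
      rw [show (∑ C ∈ (univ : Finset α).powerset, ∑ R ∈ (univ : Finset α).powerset,
            ((if O ∈ G ∧ O ⊆ C ∧ C ⊆ univ \ s then (1 : ZMod 2) else 0) *
             (if O ⊆ R ∧ R ⊆ univ \ s₀ ∧ univ \ R ∈ K then (1 : ZMod 2) else 0)))
          = (∑ C ∈ (univ : Finset α).powerset, (if O ∈ G ∧ O ⊆ C ∧ C ⊆ univ \ s then (1 : ZMod 2) else 0)) *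
            (∑ R ∈ (univ : Finset α).powerset, (if O ⊆ R ∧ R ⊆ univ \ s₀ ∧ univ \ R ∈ K then (1 : ZMod 2) else 0)) from
        (Finset.sum_mul_sum _ _ _ _).symm]
      by_cases hOG : O ∈ G
      · -- the `C`-sum is an interval parity `[O = univ \ s]`
        rw [show (∑ C ∈ (univ : Finset α).powerset, (if O ∈ G ∧ O ⊆ C ∧ C ⊆ univ \ s then (1 : ZMod 2) else 0))
            = ∑ C ∈ (univ : Finset α).powerset, (if O ⊆ C ∧ C ⊆ univ \ s then (1 : ZMod 2) else 0) from
          sum_congr rfl fun C _ => by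
            by_cases h : O ⊆ C ∧ C ⊆ univ \ s
            · rw [if_pos ⟨hOG, h⟩, if_pos h]
            · rw [if_neg (fun h' => h h'.2), if_neg h]]
        rw [sum_powerset_ite_Icc (subset_univ _)]
        by_cases hO : O = univ \ s
        · rw [if_pos hO, one_mul]
          subst hO
          refine sum_eq_zero fun R _ => ?_
          rw [if_neg]
          rintro ⟨h1, h2, -⟩
          exact hne (hρ (univ \ s) (univ \ s₀) (h1.trans h2) hscD hs₀cK)
        · rw [if_neg hO, zero_mul]
      · rw [show (∑ C ∈ (univ : Finset α).powerset, (if O ∈ G ∧ O ⊆ C ∧ C ⊆ univ \ s then (1 : ZMod 2) else 0)) = 0 from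
          sum_eq_zero fun C _ => if_neg (fun h => hOG h.1), zero_mul]
    · have hpt : ∀ C ∈ (univ : Finset α).powerset, ∀ R ∈ (univ : Finset α).powerset,
          (if (C ∈ G ∧ C ⊆ univ \ s ∧ R ⊆ univ \ s₀ ∧ univ \ R ∈ K) then
            (∑ O ∈ (univ : Finset α).powerset, (if O ∈ G ∧ O ⊆ C ∧ O ⊆ R then (1 : ZMod 2) else 0)) else 0)
          = ∑ O ∈ (univ : Finset α).powerset,
            ((if O ∈ G ∧ O ⊆ C ∧ C ⊆ univ \ s then (1 : ZMod 2) else 0) *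
             (if O ⊆ R ∧ R ⊆ univ \ s₀ ∧ univ \ R ∈ K then (1 : ZMod 2) else 0)) := by
        intro C _ R _
        by_cases h : C ∈ G ∧ C ⊆ univ \ s ∧ R ⊆ univ \ s₀ ∧ univ \ R ∈ K
        · rw [if_pos h]
          refine sum_congr rfl fun O _ => ?_
          rw [ite_zero_mul_ite_zero, one_mul]
          by_cases h' : O ∈ G ∧ O ⊆ C ∧ O ⊆ R
          · rw [if_pos h', if_pos ⟨⟨h'.1, h'.2.1, h.2.1⟩, h'.2.2, h.2.2.1, h.2.2.2⟩]
          · rw [if_neg h', if_neg (fun h'' => h' ⟨h''.1.1, h''.1.2.1, h''.2.1⟩)]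
        · rw [if_neg h]
          refine (sum_eq_zero fun O _ => ?_).symm
          rw [ite_zero_mul_ite_zero, if_neg]
          rintro ⟨⟨hOG, hOC, hCs⟩, -, hRs, hRK⟩
          exact h ⟨hG hOC hOG, hCs, hRs, hRK⟩
      calc (∑ C ∈ (univ : Finset α).powerset, ∑ R ∈ (univ : Finset α).powerset,
            (if (C ∈ G ∧ C ⊆ univ \ s ∧ R ⊆ univ \ s₀ ∧ univ \ R ∈ K) then
              (∑ O ∈ (univ : Finset α).powerset, (if O ∈ G ∧ O ⊆ C ∧ O ⊆ R then (1 : ZMod 2) else 0)) else 0))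
          = ∑ C ∈ (univ : Finset α).powerset, ∑ R ∈ (univ : Finset α).powerset, ∑ O ∈ (univ : Finset α).powerset,
              ((if O ∈ G ∧ O ⊆ C ∧ C ⊆ univ \ s then (1 : ZMod 2) else 0) *
               (if O ⊆ R ∧ R ⊆ univ \ s₀ ∧ univ \ R ∈ K then (1 : ZMod 2) else 0)) :=
            sum_congr rfl fun C hC => sum_congr rfl fun R hR => hpt C hC R hR
        _ = ∑ C ∈ (univ : Finset α).powerset, ∑ O ∈ (univ : Finset α).powerset, ∑ R ∈ (univ : Finset α).powerset,
              ((if O ∈ G ∧ O ⊆ C ∧ C ⊆ univ \ s then (1 : ZMod 2) else 0) *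
               (if O ⊆ R ∧ R ⊆ univ \ s₀ ∧ univ \ R ∈ K then (1 : ZMod 2) else 0)) :=
            sum_congr rfl fun C _ => Finset.sum_comm
        _ = _ := Finset.sum_comm
  rw [hX1, hX2, sub_zero]

end Cross

end Summit.CriticalPhenomena.PercolationContinuityZ3.Theorems.JBern
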